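import Summits.BirchSwinnertonDyer.Rank1Residual.ManinAdditive.TwistedSymbolFourier
import Summits.BirchSwinnertonDyer.Rank1Residual.ManinAdditive.DegeneracyLoopLaws
import Summits.BirchSwinnertonDyer.Rank1Residual.ManinAdditive.KatoCurveKPWitness
import HarnessLib
import HarnessLib.Audit.Tags

/-!
# THEOREM U♮: prime-class degeneracy loops of plus index prime to `3` give a tame even unit twist — and the
# W-level POLAR / KP witnesses and `3 ∤ c(W)` corollaries at squarefull level (es g22, PROVED)

Cell `bsd-f2-manin` (D-0131 (3) frontier), lens es, planner es g22 MEMO-es §36.11/§36.13 («THEOREM U», «PROVED (2)»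
2026-08-28T20:25:36Z); landed by the cell typer g14 (T-es-29 (c′)(g), landing shape per es ADDENDUM 20:27:49Z, adjusted
for DEDUP) VERBATIM from HOME/es/Sketch-es-g22-thm87.lean sha16 793791e5e4546a7e: §U (`DegeneracyClassPlusIndexPrimeTo`,
`modularSymbol_div_sub_one_mem`, `degeneracyLoopsClassTwo_subset`, THEOREM U♮ `exists_prime_unitTwist_of_degeneracyClass`,
edge `degeneracyClassPlusIndexPrimeTo_of_lawNine`; file lines 546–707), the DEGENERACY-CLASS half of §WLevel
(`threeAdicPolarWitness_of_degeneracyClassNine`, `threeAdicPolarWitness_of_classLawNine_squarefull` / `_of_sq_dvd`,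
`threeAdicKPWitness_of_degeneracyClassThree`; lines 818–890) and of §Corollary (`not_three_dvd_maninConstant_of_degeneracyClassNine`
/ `…Three`; lines 981–1014); namespace `BsdF2ManinEsG22T` ↦ `…ManinAdditive.KatoCurve`; es's verbatim copies of
`kpSignThree` / `ThreeAdicKPWitness` / `IsSquarefull` / `KatoFactThreeAtKP` / the lever are REPLACED by the tree's
(`Literature/…/KatoAdditiveTwistedValueNeronIntegralityThreeKP{,Forms}.lean`, `KatoCurveKPWitness.lean`, T-es-29 (a)(b));
`degeneracyLoopsClassTwo` and the LAW E-es-91 `DegeneracyClassLoopLawNine` live in `DegeneracyLoopLaws.lean` §4h.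
NOT LANDED here (DEDUP, they hang off prover p3's tree theorems E-es-87♭ / 87♭⁺|₄, p664349): the `ā = 0` / `4 ∣ N` W-level
theorems `threeAdicKPWitness_of_plusIndexPrimeTo_of_kpZero` / `_of_sq_dvd_of_kpZero` / `_of_four_dvd_of_kp_ne_one` and
`not_three_dvd_maninConstant_of_kpZero_squarefull` / `_of_four_dvd_squarefull` (p3's to file, Theorems side).

EVERYTHING HERE IS A SORRY-FREE THEOREM modulo named hypotheses (`DegeneracyClassPlusIndexPrimeTo`, the law (K₉)♮, the Kato
shapes `KatoFactThreeAt` / `KatoFactThreeAtKP`, additivity of `W` at `3` as two binders — in the tree `9 ∣ N` gives it only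
through the Carayol fact `IsNewformOf.level_eq_conductorNorm`).  HEADLINE (TURNKEY-es-16, C3 LEAD): **E-es-66 at squarefull
levels ⟸ (K₉)♮** — `threeAdicPolarWitness_of_classLawNine_squarefull : DegeneracyClassLoopLawNine → … → ¬good₃ → ¬mult₃ →
3 ^ 2 ∣ N → IsSquarefull N → PlusIndexPrimeTo 3 D.f → ThreeAdicPolarWitness W W D.f`; and `3 ∤ c(W)` on every composite
squarefull `9 ∣ N` class modulo `KatoFactThreeAt W D.f` + the prime-class ratio-`9` plus hypothesis
(`not_three_dvd_maninConstant_of_degeneracyClassNine`; habitat 445 classes ≤ 5000, es).  BC5 (es): POLAR-N5000 gA/gB,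
E42e K9+r 17/17.  REF1 R-es-44 (v1 §R87 CONFIRMED; v2 §U scope pending at filing) — a finding is repaired under a NEW name
(append-only).  bears_on: stmt-BirchSwinnertonDyer-22968.  PARTITION (es): composite-squarefull additive-at-3 habitat
274/445 theorem mod F₃♮, 445/445 mod F₃ + (K₉)♮ · beyond-print theorem: es says YES (lemma-level) · BSD is not proved by
this; Manin's conjecture is not proved by this.
-/

noncomputable section

open scoped Classical MatrixGroups ModularForm ComplexConjugate

open CongruenceSubgroup Complex Literature.NumberTheory.EllipticCurves
  Literature.NumberTheory.EllipticCurves.ModularForms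
open Summit.BirchSwinnertonDyer.Rank1Residual.ManinAdditive.KatoCurve
open Summit.BirchSwinnertonDyer.Rank1Residual.ManinAdditive.Gamma1Lattice

namespace Summit.BirchSwinnertonDyer.Rank1Residual.ManinAdditive.KatoCurve

section DegeneracyClass

/-! ## §U Prime-class degeneracy loops: THEOREM U♮ (es g22)

The FOURIER UNIT LEMMA behind THEOREM 87♭, made generic, and its application to the DEGENERACY LOOPS
`{∞, t·b/m} − {∞, b/m}` at PRIME denominators `m ≡ 2 (mod 3)`: if their plus parts reach a subgroup of `tr Λ_f` of
index prime to `3` (the prime-class form (K_t)♮ of the cell's degeneracy-loop law, census-backed), then `f` has a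
tame even unit twist `χ` of prime conductor with `χ(t̄) ≠ 1` — for `t = 9` a POLAR witness (`χ(3) ∉ {±1}`), for
`t = 3` a KP witness for `ā ≠ −1`.  No `3 ∣ N`, no `4 ∣ N` needed: `3 ∤ m − 1` comes from the class. -/

variable {N : ℕ} (f : CuspForm (Gamma0 N) 2)

/-- **(K_t)♮-plus hypothesis**: the plus parts of the prime-class degeneracy loops of ratio `t` reach a subgroup of
`tr Λ_f` of index prime to `p` (shape of `PlusIndexPrimeTo` / `DegeneracyPlusIndexPrimeTo`). -/
def DegeneracyClassPlusIndexPrimeTo (p t : ℕ) : Prop :=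
  ∀ x ∈ periodLattice f, ∃ y ∈ AddSubgroup.closure (degeneracyLoopsClassTwo f t),
    ∃ k : ℕ, ¬ p ∣ k ∧ (k : ℂ) * (x + starRingEnd ℂ x) = y + starRingEnd ℂ y

/-- `{∞, u/m} − {∞, 1} ∈ Λ_f` for `m ⊥ N` (the cusp `u/m` is equivalent to `0 ∼ 1`; tree
`modularSymbol_div_mul_sub_inv_mem_periodLattice` with `g = 1`). -/
theorem modularSymbol_div_sub_one_mem [NeZero N] {m : ℕ} (hm0 : m ≠ 0) (hmN : m.Coprime N) (u : ℤ) :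
    modularSymbol f ((u : ℚ) / m) - modularSymbol f 1 ∈ periodLattice f := by
  have h := modularSymbol_div_mul_sub_inv_mem_periodLattice f (g := 1) (one_dvd N)
    (by simp) (u := u) (k := m) hm0 isCoprime_one_right (by simpa using hmN)
  simpa using h

/-- Prime-class degeneracy loops lie in `Λ_f`. -/
theorem degeneracyLoopsClassTwo_subset [NeZero N] (t : ℕ) :
    degeneracyLoopsClassTwo f t ⊆ periodLattice f := by
  rintro g ⟨m, b, hmp, -, hmtN, -, rfl⟩
  have hmN : m.Coprime N :=
    (Nat.Prime.coprime_iff_not_dvd hmp).mpr (fun h => hmtN (Dvd.dvd.mul_left h t))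
  have h1 := modularSymbol_div_sub_one_mem f hmp.ne_zero hmN ((t * b : ℕ) : ℤ)
  have h2 := modularSymbol_div_sub_one_mem f hmp.ne_zero hmN ((b : ℕ) : ℤ)
  have h := sub_mem h1 h2
  push_cast at h ⊢
  simpa using h

/-- **THEOREM U♮ (f-level, es g22; PROVED).**  For a rational newform `f` whose prime-class degeneracy loops of
ratio `t` have plus index prime to `3`, there is a prime `ℓ ≡ 2 (mod 3)`, `ℓ ∤ tN`, an even primitive `χ ≠ 1`
mod `ℓ` of order prime to `3` with `χ(t̄) ≠ 1`, and `r = S_χ/Ω⁺_f` with `s·r/3 ∉ ℤ̄` for all `s ⊥ 3`. -/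
theorem exists_prime_unitTwist_of_degeneracyClass [NeZero N] (t : ℕ) (hf : IsNewform0 f)
    (hQ : coeffField f = ⊥) (hd : DegeneracyClassPlusIndexPrimeTo f 3 t) :
    ∃ (ℓ : ℕ) (_ : NeZero ℓ), ℓ.Prime ∧ ℓ % 3 = 2 ∧ ¬ ℓ ∣ t * N ∧
      ∃ (χ : DirichletCharacter ℂ ℓ) (r : ℂ),
        ℓ.Coprime (3 * N) ∧ χ.IsPrimitive ∧ χ ≠ 1 ∧ ¬ 3 ∣ orderOf χ ∧ χ (t : ZMod ℓ) ≠ 1 ∧ χ.Even ∧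
        twistedSymbolSum f χ = r * (plusPeriod f : ℂ) ∧
        ∀ s : ℕ, ¬ 3 ∣ s → ¬ _root_.IsIntegral ℤ ((s : ℂ) * r / 3) := by
  have hΩpos : 0 < plusPeriod f := IsNewform0.plusPeriod_pos_holds hf hQ
  have hΩ : plusPeriod f ≠ 0 := hΩpos.ne'
  have hΩC : (plusPeriod f : ℂ) ≠ 0 := by exact_mod_cast hΩ
  obtain ⟨hre, -⟩ := realPeriods_eq_zmultiples_of_plusPeriod_ne_zero f hΩ
  have hreal : ∀ n, (cuspCoeff f n).im = 0 := cuspCoeff_im_eq_zero_of_coeffField_eq_bot hQ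
  set S : Set ℂ := degeneracyLoopsClassTwo f t with hSdef
  have hSΛ : ∀ g ∈ S, g ∈ periodLattice f := fun g hg => degeneracyLoopsClassTwo_subset f t hg
  -- a generator with plus coordinate prime to `3`
  have hgen : ∃ g ∈ S, ∃ j : ℤ, ¬ (3 : ℤ) ∣ j ∧ g + conj g = (j : ℂ) * (plusPeriod f : ℂ) := by
    by_contra hcon
    push Not at hcon
    have hS : ∀ g ∈ S, ∃ k : ℤ, g + conj g = 3 * (k : ℂ) * (plusPeriod f : ℂ) := by
      intro g hg
      obtain ⟨j, hj⟩ := exists_add_conj_eq_int_mul f hre (hSΛ g hg)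
      have h3j : (3 : ℤ) ∣ j := by
        by_contra h3
        exact hcon g hg j h3 hj
      obtain ⟨k, rfl⟩ := h3j
      exact ⟨k, by rw [hj]; push_cast; ring⟩
    obtain ⟨x₀, hx₀, hx₀tr⟩ := exists_mem_add_conj_eq f hre
    obtain ⟨y, hy, k, hk3, hky⟩ := hd x₀ hx₀
    obtain ⟨k', hk'⟩ := add_conj_mem_three_of_closure hS hy
    have hx₀tr' : x₀ + starRingEnd ℂ x₀ = (plusPeriod f : ℂ) := hx₀tr
    have hk'' : y + starRingEnd ℂ y = 3 * (k' : ℂ) * (plusPeriod f : ℂ) := hk'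
    rw [hx₀tr', hk''] at hky
    have hkk : (k : ℂ) = 3 * (k' : ℂ) := mul_right_cancel₀ hΩC hky
    have hkz : (k : ℤ) = 3 * k' := by exact_mod_cast hkk
    exact hk3 (Int.natCast_dvd_natCast.mp ⟨k', hkz⟩)
  obtain ⟨g, hg, j, hj3, hgj⟩ := hgen
  obtain ⟨ℓ, b, hℓp, hℓ3, hℓtN, hℓb, rfl⟩ := hg
  haveI : NeZero ℓ := ⟨hℓp.ne_zero⟩
  haveI : Fact ℓ.Prime := ⟨hℓp⟩
  have hℓN : ¬ ℓ ∣ N := fun h => hℓtN (Dvd.dvd.mul_left h t)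
  have hℓt : ¬ ℓ ∣ t := fun h => hℓtN (Dvd.dvd.mul_right h N)
  have h3ℓ : ¬ (3 : ℤ) ∣ (ℓ : ℤ) - 1 := by omega
  have h3tot : ¬ (3 : ℤ) ∣ (ℓ.totient : ℤ) := by
    rw [Nat.totient_prime hℓp, Nat.cast_sub hℓp.one_lt.le]; push_cast; exact h3ℓ
  have hcop : ℓ.Coprime (3 * N) := by
    rw [Nat.Prime.coprime_iff_not_dvd hℓp]
    intro hd'
    rcases (Nat.Prime.dvd_mul hℓp).mp hd' with h | h
    · have : ℓ = 3 := (Nat.prime_dvd_prime_iff_eq hℓp Nat.prime_three).mp h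
      omega
    · exact hℓN h
  -- the units `u' = t·b̄`, `u = b̄`
  set u : ZMod ℓ := ((b : ℕ) : ZMod ℓ) with hudef
  set u' : ZMod ℓ := ((t * b : ℕ) : ZMod ℓ) with hu'def
  have hu : IsUnit u := (ZMod.isUnit_iff_coprime b ℓ).mpr ((Nat.Prime.coprime_iff_not_dvd hℓp).mpr hℓb).symm
  have hu' : IsUnit u' :=
    (ZMod.isUnit_iff_coprime (t * b) ℓ).mpr
      ((Nat.Prime.coprime_iff_not_dvd hℓp).mpr (fun h => ((Nat.Prime.dvd_mul hℓp).mp h).elim hℓt hℓb)).symm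
  have hut : IsUnit ((t : ℕ) : ZMod ℓ) :=
    (ZMod.isUnit_iff_coprime t ℓ).mpr ((Nat.Prime.coprime_iff_not_dvd hℓp).mpr hℓt).symm
  have ht0 : ((t : ℕ) : ZMod ℓ) ≠ 0 := hut.ne_zero
  have hu't : u' = (t : ZMod ℓ) * u := by rw [hu'def, hudef]; push_cast; ring
  -- the class `P` and the combination `c`
  set P : DirichletCharacter ℂ ℓ → Prop := fun χ => χ.Even ∧ χ (t : ZMod ℓ) ≠ 1 with hPdef
  set c : DirichletCharacter ℂ ℓ → ℂ := fun χ => χ u'⁻¹ + χ (-u')⁻¹ - χ u⁻¹ - χ (-u)⁻¹ with hcdef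
  have hcI : ∀ χ, P χ → IsIntegral ℤ (c χ) := by
    intro χ _
    simp only [hcdef]
    exact ((isIntegral_apply χ _).add (isIntegral_apply χ _)).sub (isIntegral_apply χ _)
      |>.sub (isIntegral_apply χ _)
  have hc0 : ∀ χ, ¬ P χ → c χ = 0 := by
    intro χ hP
    by_cases hev : χ.Even
    · -- even with `χ(t̄) = 1`: the two halves cancel
      have h1 : χ (t : ZMod ℓ) = 1 := by
        by_contra h; exact hP ⟨hev, h⟩
      have h1' : χ (t : ZMod ℓ)⁻¹ = 1 := by
        have h := map_mul χ ((t : ZMod ℓ)⁻¹) (t : ZMod ℓ)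
        rw [inv_mul_cancel₀ ht0, map_one, h1, mul_one] at h
        exact h.symm
      simp only [hcdef]
      rw [hu't, show -((t : ZMod ℓ) * u) = (t : ZMod ℓ) * (-u) by ring, mul_inv, mul_inv, map_mul, map_mul,
        h1', one_mul, one_mul]
      ring
    · -- odd character
      have hodd : χ (-1) = -1 := apply_neg_one_eq_neg_one_of_not_even hev
      simp only [hcdef]
      rw [← neg_inv, ← neg_inv, neg_eq_neg_one_mul (u'⁻¹), neg_eq_neg_one_mul (u⁻¹), map_mul, map_mul, hodd]
      ring
  -- ORTHOGONALITY at `u', −u', u, −u`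
  have hE : (ℓ.totient : ℂ) * ((j : ℂ) * (plusPeriod f : ℂ))
      = ∑ χ : DirichletCharacter ℂ ℓ, c χ * twistedSymbolSum f χ := by
    have e1 := sum_char_inv_mul_twistedSymbolSum f hu'
    have e2 := sum_char_inv_mul_twistedSymbolSum f hu'.neg
    have e3 := sum_char_inv_mul_twistedSymbolSum f hu
    have e4 := sum_char_inv_mul_twistedSymbolSum f hu.neg
    have hg : modularSymbol f (((t * b : ℕ) : ℚ) / ℓ) - modularSymbol f ((b : ℚ) / ℓ)
        + conj (modularSymbol f (((t * b : ℕ) : ℚ) / ℓ) - modularSymbol f ((b : ℚ) / ℓ))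
        = cuspValue f ℓ u' + cuspValue f ℓ (-u') - cuspValue f ℓ u - cuspValue f ℓ (-u) := by
      rw [cuspValue_neg f hreal, cuspValue_neg f hreal, hudef, hu'def, cuspValue_natCast, cuspValue_natCast,
        map_sub]
      ring
    rw [← hgj, hg]
    simp only [hcdef]
    simp_rw [sub_mul, add_mul, Finset.sum_sub_distrib, Finset.sum_add_distrib, e1, e2, e3, e4]
    ring
  obtain ⟨χ, ⟨hev, hχt⟩, hunit⟩ := exists_unitTwist_of_fourier f h3tot hΩC P c hcI hc0 hj3 hE
  have hne : χ ≠ 1 := by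
    rintro rfl
    exact hχt (MulChar.one_apply hut)
  refine ⟨ℓ, inferInstance, hℓp, hℓ3, hℓtN, χ, twistedSymbolSum f χ / (plusPeriod f : ℂ), hcop,
    isPrimitive_of_ne_one_prime hℓp hne, hne, ?_, hχt, hev, by field_simp, hunit⟩
  intro h3
  apply h3tot
  have := Int.natCast_dvd_natCast.mpr (h3.trans (orderOf_dvd_sub_one_prime hℓp χ))
  rwa [Nat.totient_prime hℓp]

/-- (K₉)♮ + plus index prime to `p` ⟹ the prime-class ratio-`9` plus hypothesis (PROVED, definitional). -/
theorem degeneracyClassPlusIndexPrimeTo_of_lawNine [NeZero N] (hlaw : DegeneracyClassLoopLawNine)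
    (h9 : 3 ^ 2 ∣ N) {p : ℕ} (hd : PlusIndexPrimeTo p f) : DegeneracyClassPlusIndexPrimeTo f p 9 := by
  intro x hx
  obtain ⟨y, hy, k, hk, hky⟩ := hd x hx
  exact ⟨y, by rw [hlaw h9 f]; exact hy, k, hk, hky⟩

end DegeneracyClass

section WLevel

open WeierstrassCurve

/-- **THEOREM U9♮ (W-level, es g22; PROVED).**  For `W` additive at `3` (two binders), `N` squarefull and the
prime-class ratio-`9` degeneracy loops of `f_W` of plus index prime to `3`, every modular parametrisation has a
`3`-adic even POLAR witness (the tree's `ThreeAdicPolarWitness`, `V = W`, `ρ = 1`): `χ(9̄) ≠ 1` forces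
`χ(3) ∉ {±1}`.  No hypothesis on `ā(W)` — all Kosters–Pannekoek symbols. -/
theorem threeAdicPolarWitness_of_degeneracyClassNine (W : WeierstrassCurve ℚ) [W.IsElliptic]
    {N : ℕ} [NeZero N] (D : ModularParametrizationData W N)
    (h3g : ¬ W.HasGoodReductionAtPrime 3) (h3m : ¬ W.HasMultiplicativeReductionAtPrime 3)
    (hsq : IsSquarefull N) (hd : DegeneracyClassPlusIndexPrimeTo D.f 3 9) :
    ThreeAdicPolarWitness W W D.f := by
  obtain ⟨m, hm, hmp, -, -, χ, r, hcop, hprim, hne, hord, h9, hev, hr, hu⟩ :=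
    exists_prime_unitTwist_of_degeneracyClass D.f 9 D.isNewformOf.1 D.isNewformOf.coeffField_eq_bot hd
  have h33 : (3 : ZMod m) * 3 = ((9 : ℕ) : ZMod m) := by push_cast; norm_num
  have h9' : χ (3 : ZMod m) * χ (3 : ZMod m) ≠ 1 := by rw [← map_mul, h33]; exact h9
  have h3a : χ (3 : ZMod m) ≠ 1 := fun h => h9' (by rw [h, mul_one])
  have h3b : χ (3 : ZMod m) ≠ -1 := fun h => h9' (by rw [h]; norm_num)
  refine ⟨m, hm, χ, r, 1, D.isNewformOf, h3g, h3m, hcop, hprim, hne, hord, h3a, h3b, hev,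
    by push_cast; ring, ?_, ?_⟩
  · have hempty : (N.primeFactors.filter fun ℓ => ¬ ℓ ^ 2 ∣ N) = ∅ :=
      Finset.filter_eq_empty_iff.mpr fun ℓ hℓ h => h (hsq ℓ hℓ)
    rw [hempty, Finset.prod_empty, one_mul]
    exact hr
  · intro s hs
    have : (s : ℂ) * r * ((1 : ℚ) : ℂ) / 3 = (s : ℂ) * r / 3 := by push_cast; ring
    rw [this]
    exact hu s hs

/-- **E-es-66|squarefull ⟸ (K₉)♮ (es g22; PROVED).**  The es-side open input of C3 v17
(`ThreeAdicWitnessOfPlusIndexPrimeToThree`, tree `PlusIndexLaws` :84) at SQUAREFULL levels, with the additivity of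
`W` at `3` as binders, follows from the single f-level law (K₉)♮. -/
theorem threeAdicPolarWitness_of_classLawNine_squarefull (hlaw : DegeneracyClassLoopLawNine)
    (W : WeierstrassCurve ℚ) [W.IsElliptic] {N : ℕ} [NeZero N] (D : ModularParametrizationData W N)
    (h3g : ¬ W.HasGoodReductionAtPrime 3) (h3m : ¬ W.HasMultiplicativeReductionAtPrime 3)
    (h9 : 3 ^ 2 ∣ N) (hsq : IsSquarefull N) (hd : PlusIndexPrimeTo 3 D.f) :
    ThreeAdicPolarWitness W W D.f :=
  threeAdicPolarWitness_of_degeneracyClassNine W D h3g h3m hsq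
    (degeneracyClassPlusIndexPrimeTo_of_lawNine D.f hlaw h9 hd)

/-- … and with a second additive prime `q ≠ 3` the plus index is free: **(K₉)♮ ⟹ polar witness for EVERY
modular parametrisation of a curve additive at `3` at a composite squarefull level** (PROVED). -/
theorem threeAdicPolarWitness_of_classLawNine_of_sq_dvd (hlaw : DegeneracyClassLoopLawNine)
    (W : WeierstrassCurve ℚ) [W.IsElliptic] {N : ℕ} [NeZero N] (D : ModularParametrizationData W N)
    (h3g : ¬ W.HasGoodReductionAtPrime 3) (h3m : ¬ W.HasMultiplicativeReductionAtPrime 3)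
    (h9 : 3 ^ 2 ∣ N) (hsq : IsSquarefull N) {q : ℕ} (hq : q.Prime) (hq3 : q ≠ 3) (hqN : q ^ 2 ∣ N) :
    ThreeAdicPolarWitness W W D.f :=
  threeAdicPolarWitness_of_classLawNine_squarefull hlaw W D h3g h3m h9 hsq
    (plusIndexPrimeTo_three_of_sq_dvd D hq hq3 hqN)

/-- **THEOREM U3♮ (W-level, es g22; PROVED).**  The ratio-`3` version gives a KP witness for `ā(W) ≠ −1`
(`χ(3̄) ≠ 1`). -/
theorem threeAdicKPWitness_of_degeneracyClassThree (W : WeierstrassCurve ℚ) [W.IsElliptic]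
    {N : ℕ} [NeZero N] (D : ModularParametrizationData W N)
    (h3g : ¬ W.HasGoodReductionAtPrime 3) (h3m : ¬ W.HasMultiplicativeReductionAtPrime 3)
    (hsq : IsSquarefull N) (h1 : kpSignThree W ≠ -1) (hd : DegeneracyClassPlusIndexPrimeTo D.f 3 3) :
    ThreeAdicKPWitness W W D.f := by
  obtain ⟨m, hm, hmp, -, -, χ, r, hcop, hprim, hne, hord, h3, hev, hr, hu⟩ :=
    exists_prime_unitTwist_of_degeneracyClass D.f 3 D.isNewformOf.1 D.isNewformOf.coeffField_eq_bot hd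
  have h3' : χ (3 : ZMod m) ≠ 1 := by exact_mod_cast h3
  have hkp : χ (3 : ZMod m) * kpSignThree W ≠ 1 := by
    rcases kpSignThree_mem W with h | h | h
    · rw [h, mul_zero]; exact zero_ne_one
    · rw [h, mul_one]; exact h3'
    · exact absurd h h1
  refine ⟨m, hm, χ, r, 1, D.isNewformOf, h3g, h3m, hcop, hprim, hne, hord, hkp, hev,
    by push_cast; ring, ?_, ?_⟩
  · have hempty : (N.primeFactors.filter fun ℓ => ¬ ℓ ^ 2 ∣ N) = ∅ :=
      Finset.filter_eq_empty_iff.mpr fun ℓ hℓ h => h (hsq ℓ hℓ)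
    rw [hempty, Finset.prod_empty, one_mul]
    exact hr
  · intro s hs
    have : (s : ℂ) * r * ((1 : ℚ) : ℂ) / 3 = (s : ℂ) * r / 3 := by push_cast; ring
    rw [this]
    exact hu s hs

end WLevel

section Corollary

open WeierstrassCurve

/-- **COROLLARY U9♮ (es g22; PROVED, tree-side lever and tree-side fact shape).**  `3 ∤ c(W)` for every
lattice-optimal modular parametrisation of `W` additive at `3` at a squarefull level whose newform satisfies the
prime-class ratio-`9` plus hypothesis — modulo ONLY the tree's `KatoFactThreeAt W D.f` (F₃ in the POLAR shape, the
typed Literature fact's instance).  All `ā`; habitat = every composite squarefull `9 ∣ N` (445 classes ≤ 5000). -/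
theorem not_three_dvd_maninConstant_of_degeneracyClassNine (W : WeierstrassCurve ℚ) [W.IsElliptic]
    [W.IsGloballyMinimal] {N : ℕ} [NeZero N] (D : ModularParametrizationData W N)
    (hF : KatoFactThreeAt W D.f)
    (hopt : ∀ z ∈ D.L.lattice, ∃ w ∈ periodLattice D.f, z = D.c * w)
    (h3g : ¬ W.HasGoodReductionAtPrime 3) (h3m : ¬ W.HasMultiplicativeReductionAtPrime 3)
    (hsq : IsSquarefull N) (hd : DegeneracyClassPlusIndexPrimeTo D.f 3 9) : ¬ (3 : ℤ) ∣ D.c := by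
  have hΩ : W.realPeriodRat = ((|D.c| : ℤ) : ℝ) * plusPeriod D.f := by
    rw [Int.cast_abs]; exact D.realPeriodRat_eq_abs_mul_plusPeriod_of_latticeEq hopt
  have hc0 : D.c ≠ 0 := D.maninConstant_ne_zero_holds
  have hwit : ThreeAdicPolarWitness W W D.f :=
    threeAdicPolarWitness_of_degeneracyClassNine W D h3g h3m hsq hd
  have h := not_three_dvd_of_katoFactThreeAt_of_witness W W D.f |D.c| hF hwit hΩ (abs_ne_zero.mpr hc0)
  exact fun h3 => h ((dvd_abs 3 D.c).mpr h3)

/-- **COROLLARY U3♮ (es g22; PROVED modulo F₃♮ as `KatoFactThreeAtKP W D.f`)**: ratio `3`, `ā(W) ≠ −1`. -/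
theorem not_three_dvd_maninConstant_of_degeneracyClassThree (W : WeierstrassCurve ℚ) [W.IsElliptic]
    [W.IsGloballyMinimal] {N : ℕ} [NeZero N] (D : ModularParametrizationData W N)
    (hF : KatoFactThreeAtKP W D.f)
    (hopt : ∀ z ∈ D.L.lattice, ∃ w ∈ periodLattice D.f, z = D.c * w)
    (h3g : ¬ W.HasGoodReductionAtPrime 3) (h3m : ¬ W.HasMultiplicativeReductionAtPrime 3)
    (hsq : IsSquarefull N) (h1 : kpSignThree W ≠ -1) (hd : DegeneracyClassPlusIndexPrimeTo D.f 3 3) :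
    ¬ (3 : ℤ) ∣ D.c := by
  have hΩ : W.realPeriodRat = ((|D.c| : ℤ) : ℝ) * plusPeriod D.f := by
    rw [Int.cast_abs]; exact D.realPeriodRat_eq_abs_mul_plusPeriod_of_latticeEq hopt
  have hc0 : D.c ≠ 0 := D.maninConstant_ne_zero_holds
  have hwit : ThreeAdicKPWitness W W D.f :=
    threeAdicKPWitness_of_degeneracyClassThree W D h3g h3m hsq h1 hd
  have h := not_three_dvd_of_katoFactThreeAtKP_of_kpWitness W W D.f |D.c| hF hwit hΩ (abs_ne_zero.mpr hc0)
  exact fun h3 => h ((dvd_abs 3 D.c).mpr h3)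

end Corollary

end Summit.BirchSwinnertonDyer.Rank1Residual.ManinAdditive.KatoCurve

end
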